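import Mathlib
import Summits.Ventures.PercRepro2.Defs
import Summits.Ventures.PercRepro2.Graph
import Summits.Ventures.PercRepro2.OneColourSwitch
import Summits.Ventures.PercRepro2.RegionHubSign
import Summits.Ventures.PercRepro2.SideSwitch
import Summits.Ventures.PercRepro2.SideSwitchFibre
import Summits.Ventures.PercRepro2.SideSwitchComps
import Summits.Ventures.PercRepro2.TermSwitchDefs
import Summits.Ventures.PercRepro2.TermSwitchFibre
import Summits.Ventures.PercRepro2.TermSwitchMono
import Summits.Ventures.PercRepro2.TermSwitchM9
import Summits.Ventures.PercRepro2.TermSwitchRestrict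
import Summits.Ventures.PercRepro2.M9LoopTransfer
import Summits.Ventures.PercRepro2.M9NoPocketDefs
import Summits.Ventures.PercRepro2.M9SingleDPocket
import Summits.Ventures.PercRepro2.M9Trichotomy
import Summits.Ventures.PercRepro2.M9EdgeTransfer
import Summits.Ventures.PercRepro2.M9GammaEval

/-!
# The four `T`-colourings of a single pair of `T`-edges sum to twice `σ_rs` of the looped graph
(blind cell PercRepro2, p3 g24, 2026-08-28; `proofs/P3-CONJG.md` §4)

For a single edge `er = d–r` and a single edge `es = d–s`: on a colouring with both `Y`, the
doubly-reached summands `[d ∈ K₂ ∧ d ∈ M₂] · σ_rs` of the four `T`-colourings (`YY`, `YW`, `WY`,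
`WW`) add up to `2 · σ_rs` of the looped graph `endsT` (`four_terms_eq`, via the Boolean identity
`four_types_identity`), the doubly-reached colourings are exactly `Sep_H ∧ DZero_H ∧ K ∧ M` for
the terminal set `H = {r, s, d}` (`gamma_iff`), and the predicate «both `T`-edges `Y`» is
invariant along the fibres of the terminal-set switch of `endsT` (`P_assignC`, `P_flipOH`).
Own work; std axioms.
-/

namespace Summit.Ventures.PercRepro2

namespace NoPocket

open Finset Classical RegionHub OneColourSwitch SideSwitch TermSwitch

variable {V : Type*} {E : Type*}

section Identity

/-- The Boolean identity behind the four `T`-colourings. -/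
lemma four_types_identity (a b yr ys wr ws : Prop) (hY : yr → ys → a) (hW : wr → ws → b) :
    (if wr ∨ ws then (1 : ℤ) - (if b then 1 else 0) else 0)
      + ((if a ∨ ys then (1 : ℤ) else 0) - (if b ∨ wr then 1 else 0))
      + ((if a ∨ yr then (1 : ℤ) else 0) - (if b ∨ ws then 1 else 0))
      + (if yr ∨ ys then (if a then (1 : ℤ) else 0) - 1 else 0)
      = 2 * ((if a then (1 : ℤ) else 0) - (if b then 1 else 0)) := by
  by_cases ha : a <;> by_cases hb : b <;> by_cases h1 : yr <;> by_cases h2 : ys <;>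
    by_cases h3 : wr <;> by_cases h4 : ws <;> simp [ha, hb, h1, h2, h3, h4] <;>
    first | exact absurd (hY h1 h2) ha | exact absurd (hW h3 h4) hb

end Identity

section Terms

variable [DecidableEq E] {ends : E → Sym2 V} {r s d : V} {er es : E}

/-- The doubly-reached summand of a colouring: `[d ∈ K₂ ∧ d ∈ M₂] · σ_rs`. -/
noncomputable def dTerm (ends : E → Sym2 V) (r s d : V) (ω : Config E) : ℤ :=
  if d ∈ K2 ends r s ω ∧ d ∈ M2 ends r s ω then sigma ends ω r s else 0

/-- **`YY`**: the summand is `[wr ∨ ws] · (1 − b)`. -/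
lemma dTerm_YY (her : ends er = s(d, r)) (hes : ends es = s(d, s)) {ω : Config E}
    (h1 : ω er = true) (h2 : ω es = true) :
    dTerm ends r s d ω =
      if Conn (endsT ends d er es) (OneColourSwitch.compl ω) d r ∨
          Conn (endsT ends d er es) (OneColourSwitch.compl ω) d s then
        1 - (if Conn (endsT ends d er es) (OneColourSwitch.compl ω) r s then 1 else 0) else 0 := by
  have hK : d ∈ K2 ends r s ω := mem_K2_of_open_er her h1
  have hrs : Conn ends ω r s := conn_rs_YY her hes h1 h2
  have eM := mem_M2_YY (ends := ends) (r := r) (s := s) (d := d) (er := er) (es := es) h1 h2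
  have eb := conn_rs_compl_YY (ends := ends) (r := r) (s := s) (d := d) (er := er) (es := es) h1 h2
  unfold dTerm sigma
  rw [if_pos hrs]
  by_cases hM : Conn (endsT ends d er es) (OneColourSwitch.compl ω) d r ∨
      Conn (endsT ends d er es) (OneColourSwitch.compl ω) d s
  · have hKM : d ∈ K2 ends r s ω ∧ d ∈ M2 ends r s ω := ⟨hK, eM.2 hM⟩
    rw [if_pos hKM, if_pos hM]
    by_cases hb : Conn (endsT ends d er es) (OneColourSwitch.compl ω) r s
    · rw [if_pos (eb.2 hb), if_pos hb]
    · rw [if_neg (fun h => hb (eb.1 h)), if_neg hb]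
  · have hKM : ¬ (d ∈ K2 ends r s ω ∧ d ∈ M2 ends r s ω) := fun h => hM (eM.1 h.2)
    rw [if_neg hKM, if_neg hM]

/-- **`YW`** (`es` flipped): the summand is `(a ∨ ys) − (b ∨ wr)`. -/
lemma dTerm_YW (her : ends er = s(d, r)) (hes : ends es = s(d, s)) (hne : er ≠ es)
    {ω : Config E} (h1 : ω er = true) :
    dTerm ends r s d (Function.update ω es false) =
      ((if Conn (endsT ends d er es) ω r s ∨ Conn (endsT ends d er es) ω d s then (1 : ℤ)
        else 0) -
        (if Conn (endsT ends d er es) (OneColourSwitch.compl ω) r s ∨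
            Conn (endsT ends d er es) (OneColourSwitch.compl ω) d r then 1 else 0)) := by
  set ω' := Function.update ω es false with hω'
  have h1' : ω' er = true := by rw [hω', Function.update_of_ne hne]; exact h1
  have h2' : ω' es = false := by rw [hω', Function.update_self]
  have hK : d ∈ K2 ends r s ω' := mem_K2_of_open_er her h1'
  have hM : d ∈ M2 ends r s ω' := mem_M2_of_closed_es hes h2'
  have hc1 : OneColourSwitch.compl ω' er = false := by simp [OneColourSwitch.compl, h1']
  have hc2 : OneColourSwitch.compl ω' es = true := by simp [OneColourSwitch.compl, h2']
  have eY := conn_rs_YW (s := s) her hne h1' h2'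
  have eW := conn_rs_WY (r := r) hes hne hc1 hc2
  have hcompl : OneColourSwitch.compl ω' = Function.update (OneColourSwitch.compl ω) es true := by
    rw [hω', M9Reduce.compl_update]; rfl
  have hKM : d ∈ K2 ends r s ω' ∧ d ∈ M2 ends r s ω' := ⟨hK, hM⟩
  unfold dTerm sigma
  rw [if_pos hKM]
  simp only [eY, eW]
  rw [hcompl, hω']
  simp only [conn_endsT_update_es (d := d) (ends := ends) hne]

/-- **`WY`** (`er` flipped): the summand is `(a ∨ yr) − (b ∨ ws)`. -/
lemma dTerm_WY (her : ends er = s(d, r)) (hes : ends es = s(d, s)) (hne : er ≠ es)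
    {ω : Config E} (h2 : ω es = true) :
    dTerm ends r s d (Function.update ω er false) =
      ((if Conn (endsT ends d er es) ω r s ∨ Conn (endsT ends d er es) ω d r then (1 : ℤ)
        else 0) -
        (if Conn (endsT ends d er es) (OneColourSwitch.compl ω) r s ∨
            Conn (endsT ends d er es) (OneColourSwitch.compl ω) d s then 1 else 0)) := by
  set ω' := Function.update ω er false with hω'
  have h1' : ω' er = false := by rw [hω', Function.update_self]
  have h2' : ω' es = true := by rw [hω', Function.update_of_ne hne.symm]; exact h2
  have hK : d ∈ K2 ends r s ω' := mem_K2_of_open_es hes h2'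
  have hM : d ∈ M2 ends r s ω' := mem_M2_of_closed_er her h1'
  have hc1 : OneColourSwitch.compl ω' er = true := by simp [OneColourSwitch.compl, h1']
  have hc2 : OneColourSwitch.compl ω' es = false := by simp [OneColourSwitch.compl, h2']
  have eY := conn_rs_WY (r := r) hes hne h1' h2'
  have eW := conn_rs_YW (s := s) her hne hc1 hc2
  have hcompl : OneColourSwitch.compl ω' = Function.update (OneColourSwitch.compl ω) er true := by
    rw [hω', M9Reduce.compl_update]; rfl
  have hKM : d ∈ K2 ends r s ω' ∧ d ∈ M2 ends r s ω' := ⟨hK, hM⟩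
  unfold dTerm sigma
  rw [if_pos hKM]
  simp only [eY, eW]
  rw [hcompl, hω']
  simp only [conn_endsT_update_er (d := d) (ends := ends) (es := es)]

/-- **`WW`** (both flipped): the summand is `[yr ∨ ys] · (a − 1)`. -/
lemma dTerm_WW (her : ends er = s(d, r)) (hes : ends es = s(d, s)) (hne : er ≠ es)
    (ω : Config E) :
    dTerm ends r s d (Function.update (Function.update ω er false) es false) =
      if Conn (endsT ends d er es) ω d r ∨ Conn (endsT ends d er es) ω d s then
        (if Conn (endsT ends d er es) ω r s then (1 : ℤ) else 0) - 1 else 0 := by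
  set ω' := Function.update (Function.update ω er false) es false with hω'
  have h1' : ω' er = false := by rw [hω', Function.update_of_ne hne, Function.update_self]
  have h2' : ω' es = false := by rw [hω', Function.update_self]
  have hM : d ∈ M2 ends r s ω' := mem_M2_of_closed_er her h1'
  have hc1 : OneColourSwitch.compl ω' er = true := by simp [OneColourSwitch.compl, h1']
  have hc2 : OneColourSwitch.compl ω' es = true := by simp [OneColourSwitch.compl, h2']
  have hrs : Conn ends (OneColourSwitch.compl ω') r s := conn_rs_YY her hes hc1 hc2
  have eK := mem_K2_WW (r := r) (s := s) (d := d) (ends := ends) (er := er) (es := es) h1' h2'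
  have eY := conn_rs_WW (r := r) (s := s) (d := d) (ends := ends) (er := er) (es := es) h1' h2'
  unfold dTerm sigma
  rw [if_pos hrs]
  by_cases hK : Conn (endsT ends d er es) ω d r ∨ Conn (endsT ends d er es) ω d s
  · have hK' : Conn (endsT ends d er es) ω' d r ∨ Conn (endsT ends d er es) ω' d s := by
      rw [hω']
      simp only [conn_endsT_update_es (d := d) (ends := ends) hne,
        conn_endsT_update_er (d := d) (ends := ends) (es := es)]
      exact hK
    have hKM : d ∈ K2 ends r s ω' ∧ d ∈ M2 ends r s ω' := ⟨eK.2 hK', hM⟩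
    rw [if_pos hKM, if_pos hK]
    by_cases ha : Conn (endsT ends d er es) ω r s
    · have ha' : Conn (endsT ends d er es) ω' r s := by
        rw [hω']
        simp only [conn_endsT_update_es (d := d) (ends := ends) hne,
          conn_endsT_update_er (d := d) (ends := ends) (es := es)]
        exact ha
      rw [if_pos (eY.2 ha'), if_pos ha]
    · have ha' : ¬ Conn (endsT ends d er es) ω' r s := by
        rw [hω']
        simp only [conn_endsT_update_es (d := d) (ends := ends) hne,
          conn_endsT_update_er (d := d) (ends := ends) (es := es)]
        exact ha
      rw [if_neg (fun h => ha' (eY.1 h)), if_neg ha]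
  · have hK' : ¬ (Conn (endsT ends d er es) ω' d r ∨ Conn (endsT ends d er es) ω' d s) := by
      rw [hω']
      simp only [conn_endsT_update_es (d := d) (ends := ends) hne,
        conn_endsT_update_er (d := d) (ends := ends) (es := es)]
      exact hK
    have hKM : ¬ (d ∈ K2 ends r s ω' ∧ d ∈ M2 ends r s ω') := fun h => hK' (eK.1 h.1)
    rw [if_neg hKM, if_neg hK]

/-- **The four `T`-colourings sum to twice `σ_rs` of the looped graph.** -/
theorem four_terms_eq (her : ends er = s(d, r)) (hes : ends es = s(d, s)) (hne : er ≠ es)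
    {ω : Config E} (h1 : ω er = true) (h2 : ω es = true) :
    dTerm ends r s d ω + dTerm ends r s d (Function.update ω es false) +
      dTerm ends r s d (Function.update ω er false) +
      dTerm ends r s d (Function.update (Function.update ω er false) es false) =
      2 * sigma (endsT ends d er es) ω r s := by
  rw [dTerm_YY her hes h1 h2, dTerm_YW her hes hne h1, dTerm_WY her hes hne h2,
    dTerm_WW her hes hne ω]
  unfold sigma
  exact four_types_identity _ _ _ _ _ _
    (fun hyr hys => conn_trans (conn_symm hyr) hys)
    (fun hwr hws => conn_trans (conn_symm hwr) hws)

end Terms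

section Gamma

variable [Fintype V] [DecidableEq V] [Fintype E] [DecidableEq E] {ends : E → Sym2 V}
  {p q r s d : V}

omit [Fintype V] [DecidableEq V] [Fintype E] [DecidableEq E] in
/-- **The doubly-reached colourings**: `Sep ∧ DOne ∧ K ∧ M ↔ Sep_H ∧ DZero_H ∧ K ∧ M` for
the terminal set `{r, s, d}`. -/
lemma gamma_iff {ω : Config E} :
    (sep2 ends p q r s ω ∧ DOne ends r s d ω ∧ d ∈ K2 ends r s ω ∧ d ∈ M2 ends r s ω) ↔
      (sepH ends p q ({r, s, d} : Set V) ω ∧ DZeroH ends ({r, s, d} : Set V) ω ∧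
        d ∈ K2 ends r s ω ∧ d ∈ M2 ends r s ω) := by
  constructor
  · rintro ⟨hsep, hD, hK, hM⟩
    refine ⟨sepH_of_sep2_of_mem_both hsep hK hM, ?_, hK, hM⟩
    intro x hxH hxK hxM
    have hxr : x ≠ r := fun h => hxH (by rw [h]; simp)
    have hxs : x ≠ s := fun h => hxH (by rw [h]; simp)
    have hxd : x ≠ d := fun h => hxH (by rw [h]; simp)
    have hxK2 : x ∈ K2 ends r s ω := by
      rcases mem_KH_triple.1 hxK with h | h | h
      · exact mem_K2_iff.2 (Or.inl h)
      · exact mem_K2_iff.2 (Or.inr h)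
      · rcases mem_K2_iff.1 hK with hd | hd
        · exact mem_K2_iff.2 (Or.inl (conn_trans hd h))
        · exact mem_K2_iff.2 (Or.inr (conn_trans hd h))
    have hxM2 : x ∈ M2 ends r s ω := by
      rcases mem_KH_triple.1 hxM with h | h | h
      · exact mem_M2_iff.2 (Or.inl h)
      · exact mem_M2_iff.2 (Or.inr h)
      · rcases mem_M2_iff.1 hM with hd | hd
        · exact mem_M2_iff.2 (Or.inl (conn_trans hd h))
        · exact mem_M2_iff.2 (Or.inr (conn_trans hd h))
    exact hD x hxr hxs hxd hxK2 hxM2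
  · rintro ⟨hsep, hD, hK, hM⟩
    refine ⟨sep2_of_sepH (by simp) (by simp) hsep, ?_, hK, hM⟩
    intro x hxr hxs hxd hxK
    have hxH : x ∉ ({r, s, d} : Set V) := by
      simp only [Set.mem_insert_iff, Set.mem_singleton_iff, not_or]
      exact ⟨hxr, hxs, hxd⟩
    exact not_mem_both_of_DZeroH (by simp) (by simp) hD hxH hxK

omit [Fintype E] in
/-- The predicate «both `T`-edges `Y`» is constant along the component assignments of the
terminal-set switch of the looped graph. -/
lemma P_assignC {er es : E} {ρ : Config E} {T : Finset (Finset V)}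
    (hT : T ⊆ compsH (endsT ends d er es) ({r, s, d} : Set V) ρ) :
    (assignC (endsT ends d er es) T ρ er = true ∧ assignC (endsT ends d er es) T ρ es = true) ↔
      (ρ er = true ∧ ρ es = true) := by
  have hd : d ∉ unionT T := by
    intro hd
    have := mem_A0H.1 (unionT_subset_A0H hT hd)
    exact this.2 (by simp)
  have key : ∀ e, endsT ends d er es e = s(d, d) →
      assignC (endsT ends d er es) T ρ e = ρ e := by
    intro e he
    simp only [assignC, assign]
    refine flipTouch_of_notMem _ ?_
    rintro ⟨x, hx, y, hxy⟩
    rw [he, Sym2.eq_iff] at hxy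
    rcases hxy with ⟨rfl, _⟩ | ⟨_, rfl⟩
    · exact hd hx
    · exact hd hx
  by_cases hne : er = es
  · subst hne
    rw [key er endsT_er]
  · rw [key er endsT_er, key es (endsT_es hne)]

omit [Fintype V] [DecidableEq V] [Fintype E] in
/-- The predicate «both `T`-edges `Y`» is invariant under the outside flip of the terminal-set
switch of the looped graph. -/
lemma P_flipOH {er es : E} (ρ : Config E) :
    (flipOH (endsT ends d er es) ({r, s, d} : Set V) ρ er = true ∧
        flipOH (endsT ends d er es) ({r, s, d} : Set V) ρ es = true) ↔
      (ρ er = true ∧ ρ es = true) := by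
  have hd : d ∉ OsetH (endsT ends d er es) ({r, s, d} : Set V) ρ := by
    intro hd
    exact hd (Or.inl (mem_KH_of_mem (by simp) ρ))
  have key : ∀ e, endsT ends d er es e = s(d, d) →
      flipOH (endsT ends d er es) ({r, s, d} : Set V) ρ e = ρ e := by
    intro e he
    simp only [flipOH]
    refine flipIn_of_notMem ?_
    rintro ⟨x, hx, y, _, hxy⟩
    rw [he, Sym2.eq_iff] at hxy
    rcases hxy with ⟨rfl, _⟩ | ⟨_, rfl⟩
    · exact hd hx
    · exact hd hx
  by_cases hne : er = es
  · subst hne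
    rw [key er endsT_er]
  · rw [key er endsT_er, key es (endsT_es hne)]

/-- **The restricted terminal-set sum of the looped graph is non-positive.** -/
theorem dzeroP_endsT_nonpos (er es : E) :
    dzeroSignSumHP (endsT ends d er es) p q r s ({r, s, d} : Set V)
      (fun ω => ω er = true ∧ ω es = true) ≤ 0 :=
  dzeroSignSumHP_nonpos p q s (by simp) _ (fun _ _ T hT => P_assignC hT)
    (fun ρ _ => P_flipOH ρ)

end Gamma

end NoPocket

end Summit.Ventures.PercRepro2
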